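import Summits.QuantumAdvantage.AdviceFreeQNC0.HardcoreToggle
import HarnessLib

/-!
# Cell qa-qnc0 — the MULTIPLICITY SURGERY engine for the law of the kernel line (planner qa-qnc0-p1 g19,
ROUND-18 §4 "transfer-matrix / second-moment counts on the hard-core law", done by counting instead)

A Peierls-type counting lemma over the kernel fibration (`card_fibre`): let `A` be a set of hard-core vectors
("bad" kernel lines) and, for EVERY position `p`, a surgery `Φ p : A → {hard-core vectors with a zero}` such that

* `Φ p` loses at most `c` zeros (`zeros v ≤ zeros (Φ p v) + c`),
* `Φ p` is at most `K`-to-one on `A`,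
* every vector is hit through at most `L` positions `p`.

Then `n · #{x odd : J(x) ∈ A} ≤ 2^{c+1}·K·L·2^{n-1}` (`mass_le_of_surgery`): the `n` surgeries spread the mass
of `A` over all odd patterns with bounded overlap.  With `c, K, L` absolute this makes `A` have density `O(1/n)`.
Consumers: the two law-of-`J` lemmas of Sketch19 §5 (`RareEvents.lean`).

Also: `hardCore_surgery_of_one`, the variant of `hardCore_surgery` whose non-vanishing comes from a prescribed
`1` inside the window.

WHAT THIS IS NOT: no strategy bound by itself; crux 22907 untouched; separation NOT moved.
-/

namespace Summit.QuantumAdvantage.AdviceFreeQNC0.Fib19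

open Finset Literature.Computability.QuantumComplexity Literature.Computability.QuantumComplexity.RingHLF

variable {n : ℕ}

/-- The surgery of `HardcoreCylinder.lean` keeps hard-coreness; non-vanishing from a `1` of the pattern inside the
window (variant of `hardCore_surgery`, whose witness was a zero of `v` outside the window). -/
theorem hardCore_surgery_of_one (S : Finset (Fin n)) (σ : Fin n → Bool)
    (hσ : ∀ i ∈ S, nxt i ∈ S → ¬ (σ i = false ∧ σ (nxt i) = false))
    (v : Fin n → Bool) (hv : ∀ i : Fin n, ¬ (v i = false ∧ v (nxt i) = false))
    {i₀ : Fin n} (hi₀W : i₀ ∈ nbhd S) (hi₀ : (fun i => if i ∈ S then σ i else true) i₀ = true) :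
    HardCore (surgery (nbhd S) (fun i => if i ∈ S then σ i else true) v) := by
  have hτS : ∀ i, (fun i => if i ∈ S then σ i else true) i = false → i ∈ S ∧ σ i = false := by
    intro i hi
    by_cases h : i ∈ S
    · simp only [h, if_true] at hi; exact ⟨h, hi⟩
    · simp only [h, if_false] at hi; exact absurd hi (by decide)
  constructor
  · rintro i ⟨h0, h1⟩
    by_cases hiW : i ∈ nbhd S
    · rw [surgery_of_mem hiW] at h0
      obtain ⟨hiS, hσi⟩ := hτS i h0
      rw [surgery_of_mem (nxt_mem_nbhd hiS)] at h1
      obtain ⟨hnS, hσn⟩ := hτS _ h1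
      exact hσ i hiS hnS ⟨hσi, hσn⟩
    · rw [surgery_of_not_mem hiW] at h0
      by_cases hnW : nxt i ∈ nbhd S
      · rw [surgery_of_mem hnW] at h1
        obtain ⟨hnS, -⟩ := hτS _ h1
        exact hiW (mem_nbhd_of_nxt_mem hnS)
      · rw [surgery_of_not_mem hnW] at h1
        exact hv i ⟨h0, h1⟩
  · exact ⟨i₀, by rw [surgery_of_mem hi₀W]; exact hi₀⟩

/-- **The multiplicity surgery engine.** -/
theorem mass_le_of_surgery (hn : 3 ≤ n) (A : Finset (Fin n → Bool))
    (Φ : Fin n → (Fin n → Bool) → (Fin n → Bool)) (c K L : ℕ)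
    (hhc : ∀ p, ∀ v ∈ A, HardCore (Φ p v) ∧ 0 < zeros (Φ p v))
    (hZ : ∀ p, ∀ v ∈ A, zeros v ≤ zeros (Φ p v) + c)
    (hK : ∀ p v', (A.filter fun v => Φ p v = v').card ≤ K)
    (hL : ∀ v', (univ.filter fun p : Fin n => ∃ v ∈ A, Φ p v = v').card ≤ L) :
    n * (univ.filter fun x : Fin n → Bool => IsOdd x ∧ kline x ∈ A).card ≤ 2 ^ (c + 1) * K * L * 2 ^ (n - 1) := by
  classical
  set fib : (Fin n → Bool) → Finset (Fin n → Bool) :=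
    fun v => univ.filter fun x : Fin n → Bool => IsOdd x ∧ kline x = v with hfib
  -- fibrewise: `#{x odd : J x ∈ A} = Σ_{v ∈ A} #fib v`
  have hE : (univ.filter fun x : Fin n → Bool => IsOdd x ∧ kline x ∈ A).card = ∑ v ∈ A, (fib v).card := by
    rw [card_filter_isOdd_eq_sum_fibre (fun v => v ∈ A)]
    apply sum_congr _ (fun _ _ => rfl)
    ext v; simp
  -- pointwise comparison along each surgery
  have hpt : ∀ p, ∀ v ∈ A, (fib v).card ≤ 2 ^ (c + 1) * (fib (Φ p v)).card := by
    intro p v hv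
    obtain ⟨hvc, hz⟩ := hhc p v hv
    calc (fib v).card ≤ 2 ^ zeros v := card_fibre_le hn v
      _ ≤ 2 ^ (zeros (Φ p v) + c) := Nat.pow_le_pow_right two_pos (hZ p v hv)
      _ = 2 ^ (c + 1) * 2 ^ (zeros (Φ p v) - 1) := by
          rw [← pow_add]; congr 1; omega
      _ = 2 ^ (c + 1) * (fib (Φ p v)).card := by rw [hfib, card_fibre hn (Φ p v) hvc hz]
  -- one surgery: `Σ_{v ∈ A} #fib v ≤ 2^{c+1} K Σ_{v' ∈ Φ_p(A)} #fib v'`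
  have hone : ∀ p, ∑ v ∈ A, (fib v).card ≤ 2 ^ (c + 1) * K * ∑ v' ∈ A.image (Φ p), (fib v').card := by
    intro p
    calc ∑ v ∈ A, (fib v).card ≤ ∑ v ∈ A, 2 ^ (c + 1) * (fib (Φ p v)).card := sum_le_sum (hpt p)
      _ = 2 ^ (c + 1) * ∑ v ∈ A, (fib (Φ p v)).card := by rw [mul_sum]
      _ = 2 ^ (c + 1) * ∑ v' ∈ A.image (Φ p), (A.filter fun v => Φ p v = v').card * (fib v').card := by
          rw [Finset.sum_comp (fun v' => (fib v').card) (Φ p)]; simp only [smul_eq_mul]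
      _ ≤ 2 ^ (c + 1) * ∑ v' ∈ A.image (Φ p), K * (fib v').card := by
          gcongr with v' _
          exact hK p v'
      _ = 2 ^ (c + 1) * K * ∑ v' ∈ A.image (Φ p), (fib v').card := by rw [← mul_sum, mul_assoc]
  -- overlap: `Σ_p Σ_{v' ∈ Φ_p(A)} f v' ≤ L · Σ_{v'} f v'`
  have hover : ∑ p : Fin n, ∑ v' ∈ A.image (Φ p), (fib v').card ≤ L * ∑ v' : Fin n → Bool, (fib v').card := by
    have hre : ∀ p : Fin n, ∑ v' ∈ A.image (Φ p), (fib v').card =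
        ∑ v' : Fin n → Bool, if v' ∈ A.image (Φ p) then (fib v').card else 0 := by
      intro p
      rw [← sum_filter]; congr 1; ext v'; simp
    simp_rw [hre]
    rw [sum_comm, mul_sum]
    refine sum_le_sum fun v' _ => ?_
    rw [← sum_filter, sum_const, smul_eq_mul]
    refine Nat.mul_le_mul_right _ (le_trans (card_le_card fun p hp => ?_) (hL v'))
    rw [mem_filter] at hp ⊢
    refine ⟨mem_univ _, ?_⟩
    have := hp.2
    rw [mem_image] at this
    obtain ⟨v, hv, hvv⟩ := this
    exact ⟨v, hv, hvv⟩
  -- total mass of all fibres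
  have htot : ∑ v' : Fin n → Bool, (fib v').card = 2 ^ (n - 1) := by
    rw [← card_isOdd (by omega : 1 ≤ n), card_eq_sum_card_fiberwise (f := kline) (t := univ)
      (by intro x _; exact mem_univ _)]
    refine sum_congr rfl fun v _ => ?_
    rw [hfib]; congr 1; ext x; simp only [mem_filter, mem_univ, true_and]
  -- assemble
  rw [hE]
  calc n * ∑ v ∈ A, (fib v).card = ∑ p : Fin n, ∑ v ∈ A, (fib v).card := by
        rw [sum_const, card_univ, Fintype.card_fin, smul_eq_mul]
    _ ≤ ∑ p : Fin n, 2 ^ (c + 1) * K * ∑ v' ∈ A.image (Φ p), (fib v').card := sum_le_sum fun p _ => hone p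
    _ = 2 ^ (c + 1) * K * ∑ p : Fin n, ∑ v' ∈ A.image (Φ p), (fib v').card := by rw [← mul_sum]
    _ ≤ 2 ^ (c + 1) * K * (L * ∑ v' : Fin n → Bool, (fib v').card) := Nat.mul_le_mul_left _ hover
    _ = 2 ^ (c + 1) * K * L * 2 ^ (n - 1) := by rw [htot]; ring

end Summit.QuantumAdvantage.AdviceFreeQNC0.Fib19
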